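import Summits.MatrixMultiplication.OmegaCensus.MetacyclicPCube

/-!
# ω-census, family (b3): conjecture C9 — `M(p³) = ℤ/p² ⋊ ℤ/p` is not box-useful for every odd `p ≥ 41`

HONEST FRAMING (pub-omega census; verbatim): lottery ticket; floor = certified bounds/negative ranges.
Census BOOKKEEPING (conjecture C9 of the cell; pub-omega stpp-1 gen 19).  The uniform construction for the metacyclic twin of the
Heisenberg family (`MetacyclicPCube`: model `Mcube p`, integer boxes, height identities, pattern lemma): ONE integer box for all `p`
— `y₁ = (0, η₁)`, `y₂ = (−1, 0)`, `w₁ = (−2, 0)`, `w₂ = (0, ω₂)` with `η₁ = 4⌊p/8⌋ + ⌊(ρ+1)/3⌋ ≈ p/2`, `ω₂ = ⌊(3p+5)/8⌋ ≈ 3p/8`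
(`ρ = p mod 8`; no Plücker constraint arises for `M(p³)`) — and nine HEIGHT INTERVALS (slopes `σ`, `λ` in `⌊p/8⌋` plus a residue
table of `O(1)` offsets), `18⌊p/8⌋ + {0, 4, 9, 9}` heights per class, i.e. box ratio `→ 9/4` again (continuum optimum of this box
family, exact slot model `18/8`).  `patIndepM_TMunif`: independent for every odd `p ≥ 41` (`omega` per column pair and multiple of
`p`, after the `p mod 8` split); `card_TMunif_bound`: `9p ≤ 5·#T`.  MAIN: **`Mcube.not_boxUseful_mcube_ge : Odd p → 41 ≤ p →
¬ BoxUseful (Mcube p)`** (+ lifts along surjections / injections) — with `He_p` (`HeisenbergClassification`) the second infinite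
UNFORCED family (all proper sections abelian) confirming C9 (b); `3 ≤ p ≤ 39` (explicit patterns, numerically in hand) is the
successor's file.  Nothing here is progress on `ω`.
-/

namespace Summit.MatrixMultiplication.OmegaCensus

open Finset ProductBoxBound

namespace Mcube

variable {p : ℕ}

/-! ### The uniform box -/

/-- `η₁ = 4⌊p/8⌋ + ⌊(p mod 8 + 1)/3⌋ ≈ p/2`. [folklore] -/
def e1 (p : ℕ) : ℕ := 4 * (p / 8) + (p % 8 + 1) / 3

/-- `ω₂ = ⌊(3p+5)/8⌋ ≈ 3p/8`. [folklore] -/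
def o2 (p : ℕ) : ℕ := (3 * p + 5) / 8

/-- The uniform integer box: `θ = (0,0,−1)`, `η = (0,η₁,0)`, `φ = (0,−2,0)`, `ω = (0,0,ω₂)`. [folklore] -/
def Bunif (p : ℕ) : IBox := ⟨![0, 0, -1], ![0, (e1 p : ℤ), 0], ![0, -2, 0], ![0, 0, (o2 p : ℤ)]⟩

/-- The uniform box is nondegenerate for `p ≥ 3`. [folklore] -/
theorem nondegM_Bunif [NeZero p] (h3 : 3 ≤ p) : (Bunif p).NondegM p := by
  have hcast : ∀ n : ℕ, 0 < n → n < p → (n : ZMod p) ≠ 0 := fun n h0 hn e =>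
    absurd (Nat.le_of_dvd h0 ((ZMod.natCast_eq_zero_iff n p).1 e)) (by omega)
  have hcast2 : ∀ n : ℕ, 0 < n → n < p ^ 2 → (n : ZMod (p ^ 2)) ≠ 0 := fun n h0 hn e =>
    absurd (Nat.le_of_dvd h0 ((ZMod.natCast_eq_zero_iff n (p ^ 2)).1 e)) (by omega)
  have hp2 : p ≤ p ^ 2 := by nlinarith
  have h1 : ((1 : ℕ) : ZMod p) ≠ 0 := hcast 1 (by omega) (by omega)
  have h2 : ((2 : ℕ) : ZMod p) ≠ 0 := hcast 2 (by omega) (by omega)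
  have he : ((e1 p : ℕ) : ZMod (p ^ 2)) ≠ 0 := hcast2 _ (by unfold e1; omega) (by unfold e1; omega)
  have ho : ((o2 p : ℕ) : ZMod (p ^ 2)) ≠ 0 := hcast2 _ (by unfold o2; omega) (by unfold o2; omega)
  have h1n : (1 : ZMod p) ≠ 0 := by exact_mod_cast h1
  have h2n : (2 : ZMod p) ≠ 0 := by exact_mod_cast h2
  have h1n' : (-1 : ZMod p) ≠ 0 := neg_ne_zero.2 h1n
  have h2n' : (-2 : ZMod p) ≠ 0 := neg_ne_zero.2 h2n
  constructor
  · intro i j h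
    have ht := congrArg Mcube.t h
    have hx := congrArg Mcube.x h
    fin_cases i <;> fin_cases j <;>
      simp [IBox.yM, Bunif, mk', h1n', h1n'.symm, he, he.symm] at ht hx ⊢
  · intro i j h
    have ht := congrArg Mcube.t h
    have hx := congrArg Mcube.x h
    fin_cases i <;> fin_cases j <;>
      simp [IBox.wM, Bunif, mk', h2n', h2n'.symm, ho, ho.symm] at ht hx ⊢

/-! ### The nine height intervals -/

/-- Start slopes `σ(i,j)` (per `⌊p/8⌋`). [folklore] -/
def sigM : Fin 3 → Fin 3 → ℤ := ![![6, 0, 0], ![2, 4, 4], ![3, 5, 0]]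
/-- Length slopes `λ(i,j)` (per `⌊p/8⌋`). [folklore] -/
def lamM : Fin 3 → Fin 3 → ℤ := ![![2, 2, 2], ![2, 2, 2], ![2, 1, 3]]

/-- Start offsets by residue `p mod 8 ∈ {1,3,5,7}`. [folklore] -/
def s0M (ρ : ℕ) : Fin 3 → Fin 3 → ℤ :=
  if ρ = 1 then ![![1, 0, 0], ![0, 0, -1], ![0, -1, 0]]
  else if ρ = 3 then ![![2, 0, 0], ![1, 1, 0], ![-1, 0, 0]]
  else if ρ = 5 then ![![3, 0, -1], ![0, 1, 0], ![-1, 0, -1]]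
  else ![![3, 0, 0], ![0, 3, 0], ![-1, 0, 0]]

/-- Length offsets by residue `p mod 8 ∈ {1,3,5,7}`. [folklore] -/
def l0M (ρ : ℕ) : Fin 3 → Fin 3 → ℤ :=
  if ρ = 1 then ![![0, -1, 0], ![-1, -1, 2], ![-1, 2, 0]]
  else if ρ = 3 then ![![1, 1, -1], ![-1, 1, 1], ![1, 2, -1]]
  else if ρ = 5 then ![![1, 0, 0], ![0, 1, 3], ![1, 3, 0]]
  else ![![4, 0, -1], ![0, 0, 3], ![1, 3, -1]]

/-- Interval starts. [folklore] -/
def loM (p : ℕ) (i j : Fin 3) : ℤ := sigM i j * (p / 8 : ℕ) + s0M (p % 8) i j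
/-- Interval lengths. [folklore] -/
def lenM (p : ℕ) (i j : Fin 3) : ℕ := (lamM i j * (p / 8 : ℕ) + l0M (p % 8) i j).toNat

/-- The heights of column `(i,j)`. [folklore] -/
def colSetM (p : ℕ) (c : Fin 3 × Fin 3) : Finset ((Fin 3 × Fin 3) × ZMod p) :=
  (range (lenM p c.1 c.2)).image fun k : ℕ => (c, ((loM p c.1 c.2 + (k : ℤ) : ℤ) : ZMod p))

/-- The uniform pattern. [folklore] -/
def TMunif (p : ℕ) : Finset ((Fin 3 × Fin 3) × ZMod p) := univ.biUnion (colSetM p)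

/-- Membership in the uniform pattern. [folklore] -/
theorem mem_TMunif {a : (Fin 3 × Fin 3) × ZMod p} :
    a ∈ TMunif p ↔ ∃ (i j : Fin 3) (k : ℕ), k < lenM p i j ∧ a = ((i, j), ((loM p i j + (k : ℤ) : ℤ) : ZMod p)) := by
  constructor
  · intro ha
    obtain ⟨c, -, hc⟩ := mem_biUnion.1 ha
    obtain ⟨k, hk, rfl⟩ := mem_image.1 hc
    exact ⟨c.1, c.2, k, mem_range.1 hk, rfl⟩
  · rintro ⟨i, j, k, hk, rfl⟩
    exact mem_biUnion.2 ⟨(i, j), mem_univ _, mem_image.2 ⟨k, mem_range.2 hk, rfl⟩⟩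

/-- Lengths are at most `p` (odd `p ≥ 41`). [folklore] -/
theorem lenM_le (hp : p % 2 = 1) (h41 : 41 ≤ p) (i j : Fin 3) : lenM p i j ≤ p := by
  rcases (by omega : p % 8 = 1 ∨ p % 8 = 3 ∨ p % 8 = 5 ∨ p % 8 = 7) with h8 | h8 | h8 | h8 <;>
    fin_cases i <;> fin_cases j <;> simp [lenM, lamM, l0M, h8] <;> omega

/-- Each column contributes `len` heights. [folklore] -/
theorem card_colSetM (hp : p % 2 = 1) (h41 : 41 ≤ p) (c : Fin 3 × Fin 3) : #(colSetM p c) = lenM p c.1 c.2 := by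
  rw [colSetM, card_image_of_injOn, card_range]
  intro k hk k' hk' e
  simp only [coe_range, Set.mem_Iio] at hk hk'
  simp only [Prod.mk.injEq, true_and] at e
  have hl := lenM_le hp h41 c.1 c.2
  have hd : (p : ℤ) ∣ (loM p c.1 c.2 + k) - (loM p c.1 c.2 + k') := by
    rw [← ZMod.intCast_zmod_eq_zero_iff_dvd]; push_cast at e ⊢; linear_combination e
  have := IBox.eq_of_dvd_of_lt hd (by omega) (by omega)
  omega

/-- The uniform pattern has `∑ len` entries. [folklore] -/
theorem card_TMunif (hp : p % 2 = 1) (h41 : 41 ≤ p) : #(TMunif p) = ∑ i : Fin 3, ∑ j : Fin 3, lenM p i j := by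
  rw [TMunif, card_biUnion]
  · rw [← univ_product_univ, sum_product]
    exact sum_congr rfl fun i _ => sum_congr rfl fun j _ => card_colSetM hp h41 (i, j)
  · intro c _ c' _ hcc'
    rw [Function.onFun, disjoint_left]
    intro a ha ha'
    obtain ⟨k, -, rfl⟩ := mem_image.1 ha
    obtain ⟨k', -, e⟩ := mem_image.1 ha'
    exact hcc' (congrArg Prod.fst e).symm

/-- **The count**: `9p ≤ 5·#TMunif` for odd `p ≥ 41` (`#TMunif = 18⌊p/8⌋ + {0,4,9,9}`). [folklore] -/
theorem card_TMunif_bound (hp : p % 2 = 1) (h41 : 41 ≤ p) : 9 * p ≤ 5 * #(TMunif p) := by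
  rw [card_TMunif hp h41]
  simp only [Fin.sum_univ_three]
  rcases (by omega : p % 8 = 1 ∨ p % 8 = 3 ∨ p % 8 = 5 ∨ p % 8 = 7) with h8 | h8 | h8 | h8 <;>
    simp [lenM, lamM, l0M, h8] <;> omega

/-- Multiples of `p` of absolute value `< 6p`. [folklore] -/
theorem eq_mul_of_dvd_of_lt6 {e : ℤ} (h : (p : ℤ) ∣ e) (h1 : -(6 * (p : ℤ)) < e) (h2 : e < 6 * p) :
    ∃ t : ℤ, e = p * t ∧ -5 ≤ t ∧ t ≤ 5 := by
  obtain ⟨t, rfl⟩ := h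
  have hp : (0 : ℤ) ≤ p := Int.natCast_nonneg p
  refine ⟨t, rfl, ?_, ?_⟩
  · by_contra ht
    have : (p : ℤ) * t ≤ p * (-6) := Int.mul_le_mul_of_nonneg_left (by omega) hp
    omega
  · by_contra ht
    have : (p : ℤ) * 6 ≤ p * t := Int.mul_le_mul_of_nonneg_left (by omega) hp
    omega

set_option maxHeartbeats 8000000 in
/-- **Independence of the uniform pattern** (odd `p ≥ 41`): per residue `p mod 8`, column pair and multiple of `p`, linear
arithmetic (`omega`). [folklore] -/
theorem patIndepM_TMunif (hp : p % 2 = 1) (h41 : 41 ≤ p) : (Bunif p).PatIndepM p (TMunif p) := by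
  intro a ha b hb hab heq
  obtain ⟨i, j, k, hk, rfl⟩ := mem_TMunif.1 ha
  obtain ⟨i', j', k', hk', rfl⟩ := mem_TMunif.1 hb
  have hne : ((i, j) : Fin 3 × Fin 3) ≠ (i', j') ∨ k ≠ k' := by
    by_contra hcon
    push Not at hcon
    obtain ⟨hc, hkk⟩ := hcon
    simp only [Prod.mk.injEq] at hc
    obtain ⟨rfl, rfl⟩ := hc
    subst hkk
    exact hab rfl
  have hdvd : (p : ℤ) ∣ (loM p i j + (k : ℤ)) - (loM p i' j' + (k' : ℤ)) - (Bunif p).tauI (i, j) (i', j') := by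
    rw [← ZMod.intCast_zmod_eq_zero_iff_dvd]
    push_cast at heq ⊢
    linear_combination heq
  clear hab heq ha hb
  rcases (by omega : p % 8 = 1 ∨ p % 8 = 3 ∨ p % 8 = 5 ∨ p % 8 = 7) with h8 | h8 | h8 | h8 <;>
    fin_cases i <;> fin_cases j <;> fin_cases i' <;> fin_cases j' <;>
    simp [loM, lenM, sigM, lamM, s0M, l0M, IBox.tauI, Bunif, e1, o2, h8] at hk hk' hne hdvd <;>
    (obtain ⟨t, ht, ht1, ht2⟩ := eq_mul_of_dvd_of_lt6 hdvd (by omega) (by omega); interval_cases t <;> omega)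

/-- **`M(p³)` is not box-useful for every odd `p ≥ 41`.** [folklore] -/
theorem not_boxUseful_mcube_ge [NeZero p] (hp : Odd p) (h41 : 41 ≤ p) : ¬ BoxUseful (Mcube p) :=
  (Bunif p).not_boxUseful_of_pattern (nondegM_Bunif (by omega)) (patIndepM_TMunif (Nat.odd_iff.1 hp) h41)
    (card_TMunif_bound (Nat.odd_iff.1 hp) h41)

end Mcube

end Summit.MatrixMultiplication.OmegaCensus
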